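import Summits.QuantumAdvantage.AdviceFreeQNC0.AffBells23RingCond
import HarnessLib

/-!
# Sketch23 §4 + §4b (planner qn-p1 g23, ROUND-22 §2; ask P-23e): the frame-averaging cross term in VARIANCE form,
# BLOCK DECORRELATION (T1, statement) and LEMMA JPD (conditional width-one decorrelation, proved)

Verbatim copy of `HOME/qa-qnc0-p1/exp23/Sketch23.lean` §4 and §4b (authored by the planner seat qn-p1 g23, landed by
qn-prover-3 g12; only this header is new):

* §4 statements (prover targets P-23d): `blockSum`, `NonConstOn`, **`BlockDecorrelation`** (T1: pool-over-disjoint-blocks juntas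
  decorrelate from every character non-constant on many blocks, rate `(3/4)^{#blocks}`), **`VarianceDecorrelationBound`**
  (Cauchy–Schwarz + Parseval on `𝔽₃^m`);
* §4b: the averaging identity `RingCond.sum_sum_merge`, **`CondWidthOne` / `condWidthOne`** (PROVED: split the exponent along
  `A`, `TwoModuli.charVsProduct` on each part), **LEMMA JPD `JuntaProductDecorrelation` / `juntaProductDecorrelation`** (PROVED:
  a transversal makes a junta product width-one on every part), and the corollary statement **`VDOfJPD`** (prover target, S:
  Turán transversal + `rpow` bookkeeping — see `AffBells23Transversal` for the transversal).

The tree also holds the `IsCoordProduct`/`stdAddChar` form of JPD (`AffBells23JuntaProduct`, planner's companion file).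
Separation NOT moved.
-/

noncomputable section

open Classical

namespace Summit.QuantumAdvantage.AdviceFreeQNC0

open Finset
open Literature.Computability.QuantumComplexity Literature.Computability.QuantumComplexity.RingHLF
open Literature.Computability.MetaComplexity Literature.Computability.MetaComplexity.Smolensky
open F4 TubePlanProof AffBells22

namespace AffBells23

/-! ## §4 (G3) — the cross term of frame averaging in VARIANCE form, and BLOCK DECORRELATION (tool T1)

ROUND-22 §2.  With PURE frame tables the frame-averaging cross term is bounded by the standard deviation, over the frame value `y`,
of the conditional mean of the sign `G₀` of all other bells (Cauchy–Schwarz on `𝔽₃^m` + Parseval), so what is needed of the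
non-frame bells is only `Σ_{t ≠ 0} |E_F[G₀(F) ω^{⟨tV,F⟩}]|² ≤ ε²` (VARIANCE DECORRELATION).  Tool T1 below gives it, with
exponential rate, for bells that read the coins only through the sums of DISJOINT blocks (pool-over-blocks juntas of ANY width,
any number, any pool structure), provided the frame is regular MODULO the block algebra. -/

/-- block sum mod 3 of the coins in `B`. -/
def blockSum {Z : ℕ} (B : Finset (Fin Z)) (F : Fin Z → Bool) : ZMod 3 :=
  ∑ p ∈ B, (if F p then (1 : ZMod 3) else 0)

/-- `γ` is non-constant on the block `B`. -/
def NonConstOn {Z : ℕ} (γ : Fin Z → ZMod 3) (B : Finset (Fin Z)) : Prop := ∃ p ∈ B, ∃ q ∈ B, γ p ≠ γ q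

/-- **T1 `BlockDecorrelation`** (prover target, S–M, elementary): for DISJOINT blocks `B i`, any `Ψ` of the block sums with `|Ψ| ≤ 1`
and any `γ`, `‖Σ_F Ψ(blockSums F)·ω^{⟨γ,F⟩}‖ ≤ 2^Z · (3/4)^{#{i : γ non-constant on B i}}`.
Proof: condition on the block sums `s`; given `s` the blocks are independent; for ONE block `B` of size `w` and `γ_B` non-constant,
`E_s |E[ω^{⟨γ_B,F_B⟩} | Σ F_B ≡ s]| ≤ (Σ_{j ∈ 𝔽₃} 4^{−n_j})^{1/2} ≤ 3/4` with `n_j = #{p ∈ B : γ_p ≠ −j} ≥ 1` (Cauchy–Schwarz over `s`,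
Plancherel over `j`, `|1 + ω^{a}|/2 = 1/2` for `a ≠ 0`); coins outside `⋃ B i` and constant blocks contribute factors of modulus `≤ 1`. -/
def BlockDecorrelation : Prop :=
  ∀ (Z M : ℕ) (B : Fin M → Finset (Fin Z)), (∀ i j, i ≠ j → Disjoint (B i) (B j)) →
    ∀ (Ψ : (Fin M → ZMod 3) → ℂ), (∀ s, ‖Ψ s‖ ≤ 1) → ∀ γ : Fin Z → ZMod 3,
      ‖∑ F : Fin Z → Bool, Ψ (fun i => blockSum (B i) F) *
          Complex.exp (2 * Real.pi * Complex.I / 3) ^ (∑ p, if F p then (γ p).val else 0)‖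
        ≤ (2 : ℝ) ^ Z * (3 / 4 : ℝ) ^ (univ.filter fun i : Fin M => NonConstOn γ (B i)).card

/-- **`VarianceDecorrelationBound`** — the abstract Cauchy–Schwarz/Parseval step behind the variance form of the cross term
(prover target, S; pure finite Fourier analysis on `𝔽₃^m`): for `g : 𝔽₃^m → ℂ` with `E_y |g y|² ≤ 1` (uniform `y`) and Fourier
coefficients `ĝ_t = 3^{-m} Σ_y g(y) ω^{-⟨t,y⟩}`, and any complex numbers `H t` (`t ≠ 0`; in the application `H t = E_F[G₀ ω^{⟨t,V F⟩}]`),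
`|Σ_{t ≠ 0} ĝ_t H_t| ≤ (Σ_{t ≠ 0} |H_t|²)^{1/2}`.  Stated with the pairing `⟨t,y⟩ = Σ t_l y_l` read in `ℕ` through `ZMod.val`. -/
def VarianceDecorrelationBound : Prop :=
  ∀ (m : ℕ) (g : (Fin m → ZMod 3) → ℂ) (H : (Fin m → ZMod 3) → ℂ),
    (∑ y : Fin m → ZMod 3, ‖g y‖ ^ 2) ≤ (3 : ℝ) ^ m →
      ‖∑ t ∈ (univ.filter fun t : Fin m → ZMod 3 => t ≠ 0),
          ((3 : ℂ) ^ m)⁻¹ * (∑ y : Fin m → ZMod 3, g y *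
              (Complex.exp (2 * Real.pi * Complex.I / 3) ^ (∑ l, (t l * y l).val))⁻¹) * H t‖
        ≤ Real.sqrt (∑ t ∈ (univ.filter fun t : Fin m → ZMod 3 => t ≠ 0), ‖H t‖ ^ 2)

/-! ## §4b (G3) per character — CONDITIONAL WIDTH-ONE DECORRELATION over the tree's `charVsProduct` (ROUND-22 §2.5, LEMMA JPD)

The per-character correlation of a PRODUCT OF ±1 JUNTA TABLES with a MOD₃ character needs no degree hypothesis: condition on the coins
outside a transversal `A` (a set meeting every junta support at most once); what is left is a width-one product, i.e. `charVsProduct`.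
`condWidthOne` below is the analytic half (PROVED); `JuntaProductDecorrelation` is the statement with the combinatorial regrouping
(typed; S); `VDOfJPD` is the corollary feeding FA-Var (typed; S). -/

/-- **Averaging identity for sums**: `∑_b ∑_u f(merge_A b u) = 2^Z • ∑_F f F` (the involution `RingCond.mergeSwap`). -/
theorem RingCond.sum_sum_merge {Z : ℕ} {M : Type*} [AddCommMonoid M] (A : Finset (Fin Z)) (f : (Fin Z → Bool) → M) :
    ∑ b : Fin Z → Bool, ∑ u : Fin Z → Bool, f (subcubeMerge A b u) = 2 ^ Z • ∑ F : Fin Z → Bool, f F := by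
  have h1 : ∑ b : Fin Z → Bool, ∑ u : Fin Z → Bool, f (subcubeMerge A b u)
      = ∑ p : (Fin Z → Bool) × (Fin Z → Bool), f (subcubeMerge A p.1 p.2) := by
    rw [Fintype.sum_prod_type]
  have h2 : ∑ p : (Fin Z → Bool) × (Fin Z → Bool), f (subcubeMerge A p.1 p.2)
      = ∑ p : (Fin Z → Bool) × (Fin Z → Bool), f p.1 :=
    Fintype.sum_equiv (RingCond.mergeSwap A) _ _ (fun p => rfl)
  have h3 : ∑ p : (Fin Z → Bool) × (Fin Z → Bool), f p.1 = 2 ^ Z • ∑ F : Fin Z → Bool, f F := by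
    rw [Fintype.sum_prod_type]
    have inner : ∀ a : Fin Z → Bool, (∑ _b : Fin Z → Bool, f a) = 2 ^ Z • f a := by
      intro a
      rw [Finset.sum_const, Finset.card_univ, Fintype.card_fun, Fintype.card_bool, Fintype.card_fin]
    rw [Finset.sum_congr rfl (fun a _ => inner a), ← Finset.smul_sum]
  rw [h1, h2, h3]

/-- **`CondWidthOne`** (the analytic half of JPD): if on every part `{F |_(Aᶜ) = u}` the function `G` is a constant of modulus `≤ 1` times a
WIDTH-ONE sign product `Π_p s_p^{b_p}`, then `|Σ_F ω^{⟨γ,F⟩} G(F)| ≤ 2^Z (√3/2)^{#{p ∈ A : γ_p ≠ 0}}`. -/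
def CondWidthOne : Prop :=
  ∀ (Z : ℕ) (A : Finset (Fin Z)) (γ : Fin Z → ZMod 3) (G : (Fin Z → Bool) → ℂ),
    (∀ u : Fin Z → Bool, ∃ (c : ℂ) (s : Fin Z → Bool), ‖c‖ ≤ 1 ∧
        ∀ b : Fin Z → Bool, G (subcubeMerge A b u) = c * ∏ p, (if b p ∧ s p then (-1 : ℂ) else 1)) →
      ‖∑ F : Fin Z → Bool, Complex.exp (2 * Real.pi * Complex.I / 3) ^ (∑ p, if F p then (γ p).val else 0) * G F‖
        ≤ (2 : ℝ) ^ Z * (Real.sqrt 3 / 2) ^ (A.filter fun p => γ p ≠ 0).card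

/-- **`CondWidthOne` PROVED** (split the exponent along `A`, `TwoModuli.charVsProduct` on each part, average over the parts with `sum_sum_merge`). -/
theorem condWidthOne : CondWidthOne := by
  intro Z A γ G hG
  have hωn : ‖Complex.exp (2 * Real.pi * Complex.I / 3)‖ = 1 := by rw [Complex.norm_exp]; simp
  -- the character split along `A`
  set γA : Fin Z → ZMod 3 := fun p => if p ∈ A then γ p else 0 with hγA
  set γO : Fin Z → ZMod 3 := fun p => if p ∈ A then 0 else γ p with hγO
  have hexp : ∀ b u : Fin Z → Bool,
      (∑ p, if subcubeMerge A b u p then (γ p).val else 0)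
        = (∑ p, if b p then (γA p).val else 0) + (∑ p, if u p then (γO p).val else 0) := by
    intro b u
    rw [← Finset.sum_add_distrib]
    refine Finset.sum_congr rfl fun p _ => ?_
    unfold subcubeMerge
    simp only [hγA, hγO]
    by_cases hp : p ∈ A
    · simp [hp]
    · simp [hp]
  have hwt : (univ.filter fun p => γA p ≠ 0).card = (A.filter fun p => γ p ≠ 0).card := by
    congr 1
    ext p
    simp only [mem_filter, mem_univ, true_and, hγA]
    by_cases hp : p ∈ A
    · simp [hp]
    · simp [hp]
  -- the bound on each part
  have hu : ∀ u : Fin Z → Bool,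
      ‖∑ b : Fin Z → Bool, Complex.exp (2 * Real.pi * Complex.I / 3) ^ (∑ p, if subcubeMerge A b u p then (γ p).val else 0)
          * G (subcubeMerge A b u)‖
        ≤ (2 : ℝ) ^ Z * (Real.sqrt 3 / 2) ^ (A.filter fun p => γ p ≠ 0).card := by
    intro u
    obtain ⟨c, s, hc, hcs⟩ := hG u
    have hrw : ∑ b : Fin Z → Bool, Complex.exp (2 * Real.pi * Complex.I / 3) ^ (∑ p, if subcubeMerge A b u p then (γ p).val else 0)
          * G (subcubeMerge A b u)
        = (c * Complex.exp (2 * Real.pi * Complex.I / 3) ^ (∑ p, if u p then (γO p).val else 0)) *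
          ∑ b : Fin Z → Bool, Complex.exp (2 * Real.pi * Complex.I / 3) ^ (∑ p, if b p then (γA p).val else 0)
            * ∏ p, (if b p ∧ s p then (-1 : ℂ) else 1) := by
      rw [Finset.mul_sum]
      refine Finset.sum_congr rfl fun b _ => ?_
      rw [hexp b u, pow_add, hcs b]
      ring
    rw [hrw, norm_mul, norm_mul, norm_pow, hωn, one_pow, mul_one]
    have hcv := TwoModuli.charVsProduct Z γA s
    rw [hwt] at hcv
    calc ‖c‖ * ‖∑ b : Fin Z → Bool, Complex.exp (2 * Real.pi * Complex.I / 3) ^ (∑ p, if b p then (γA p).val else 0)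
            * ∏ p, (if b p ∧ s p then (-1 : ℂ) else 1)‖
        ≤ 1 * ((2 : ℝ) ^ Z * (Real.sqrt 3 / 2) ^ (A.filter fun p => γ p ≠ 0).card) :=
          mul_le_mul hc hcv (norm_nonneg _) zero_le_one
      _ = (2 : ℝ) ^ Z * (Real.sqrt 3 / 2) ^ (A.filter fun p => γ p ≠ 0).card := one_mul _
  -- average over the parts
  have hid := RingCond.sum_sum_merge A
    (fun F => Complex.exp (2 * Real.pi * Complex.I / 3) ^ (∑ p, if F p then (γ p).val else 0) * G F)
  have h2Z : (2 : ℂ) ^ Z ≠ 0 := pow_ne_zero _ two_ne_zero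
  have h2R : (2 : ℝ) ^ Z ≠ 0 := pow_ne_zero _ two_ne_zero
  have hsum : ∑ F : Fin Z → Bool, Complex.exp (2 * Real.pi * Complex.I / 3) ^ (∑ p, if F p then (γ p).val else 0) * G F
      = ((2 : ℂ) ^ Z)⁻¹ * ∑ u : Fin Z → Bool, ∑ b : Fin Z → Bool,
          Complex.exp (2 * Real.pi * Complex.I / 3) ^ (∑ p, if subcubeMerge A b u p then (γ p).val else 0)
            * G (subcubeMerge A b u) := by
    rw [Finset.sum_comm, hid, nsmul_eq_mul, Nat.cast_pow, Nat.cast_ofNat, ← mul_assoc, inv_mul_cancel₀ h2Z, one_mul]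
  rw [hsum, norm_mul, norm_inv, norm_pow, Complex.norm_two]
  calc ((2 : ℝ) ^ Z)⁻¹ * ‖∑ u : Fin Z → Bool, ∑ b : Fin Z → Bool,
          Complex.exp (2 * Real.pi * Complex.I / 3) ^ (∑ p, if subcubeMerge A b u p then (γ p).val else 0)
            * G (subcubeMerge A b u)‖
      ≤ ((2 : ℝ) ^ Z)⁻¹ * ∑ u : Fin Z → Bool, ‖∑ b : Fin Z → Bool,
          Complex.exp (2 * Real.pi * Complex.I / 3) ^ (∑ p, if subcubeMerge A b u p then (γ p).val else 0)
            * G (subcubeMerge A b u)‖ :=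
        mul_le_mul_of_nonneg_left (norm_sum_le _ _) (by positivity)
    _ ≤ ((2 : ℝ) ^ Z)⁻¹ * ∑ _u : Fin Z → Bool, (2 : ℝ) ^ Z * (Real.sqrt 3 / 2) ^ (A.filter fun p => γ p ≠ 0).card :=
        mul_le_mul_of_nonneg_left (Finset.sum_le_sum fun u _ => hu u) (by positivity)
    _ = (2 : ℝ) ^ Z * (Real.sqrt 3 / 2) ^ (A.filter fun p => γ p ≠ 0).card := by
        rw [Finset.sum_const, Finset.card_univ, Fintype.card_fun, Fintype.card_bool, Fintype.card_fin, nsmul_eq_mul]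
        push_cast
        rw [← mul_assoc, inv_mul_cancel₀ h2R, one_mul]

/-- **LEMMA JPD `JuntaProductDecorrelation`** (ROUND-22 §2.5; PROVED below over `condWidthOne` by the regrouping "a transversal makes the product
width-one on every part"): for `±1` junta tables `σ_k` reading `S_k`, a character `γ`, and `A ⊆ supp γ` meeting every `S_k` at most once,
`|Σ_F ω^{⟨γ,F⟩} Π_k σ_k(F)| ≤ 2^Z (√3/2)^{|A|}`.  No degree hypothesis, no width hypothesis (width enters only through the size of transversals:
Caro–Wei gives `|A| ≥ wt(γ)²/(wt(γ) + Σ_k |S_k|(|S_k|−1))`).  Sharp in the exponent's TYPE: aligned disjoint width-`L` tests give `(≈2/3)^{Z/L}` (kit j303617). -/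
def JuntaProductDecorrelation : Prop :=
  ∀ (Z K : ℕ) (S : Fin K → Finset (Fin Z)) (σ : Fin K → (Fin Z → Bool) → Bool) (γ : Fin Z → ZMod 3) (A : Finset (Fin Z)),
    (∀ k, ReadsOnly (S k) (σ k)) → (∀ k, (S k ∩ A).card ≤ 1) → (∀ p ∈ A, γ p ≠ 0) →
      ‖∑ F : Fin Z → Bool, Complex.exp (2 * Real.pi * Complex.I / 3) ^ (∑ p, if F p then (γ p).val else 0) *
          ∏ k, (if σ k F then (-1 : ℂ) else 1)‖
        ≤ (2 : ℝ) ^ Z * (Real.sqrt 3 / 2) ^ A.card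

/-- **LEMMA JPD PROVED** (`juntaProductDecorrelation`): on each part `{F|_(Aᶜ) = u}` regroup the product by the unique point of `S_k ∩ A`
(tables with `S_k ∩ A = ∅` are constant on the part, the others are functions of one bit `b_p`, and a `±1`-valued function of one bit is
`h(0)·(h(0)h(1))^{b}`), then `condWidthOne`. -/
theorem juntaProductDecorrelation : JuntaProductDecorrelation := by
  intro Z K S σ γ A hread hA hγ
  have hfilt : (A.filter fun p => γ p ≠ 0) = A := Finset.filter_true_of_mem hγ
  suffices hparts : ∀ u : Fin Z → Bool, ∃ (c : ℂ) (s : Fin Z → Bool), ‖c‖ ≤ 1 ∧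
      ∀ b : Fin Z → Bool, (fun F => ∏ k, (if σ k F then (-1 : ℂ) else 1)) (subcubeMerge A b u)
        = c * ∏ p, (if b p ∧ s p then (-1 : ℂ) else 1) by
    have h := condWidthOne Z A γ (fun F => ∏ k, (if σ k F then (-1 : ℂ) else 1)) hparts
    rw [hfilt] at h
    exact h
  intro u
  set b₀ : Fin Z → Bool := fun _ => false with hb₀
  set X : Fin K → (Fin Z → Bool) → ℂ := fun k b => if σ k (subcubeMerge A b u) then (-1 : ℂ) else 1 with hX
  set Kp : Fin Z → Finset (Fin K) := fun p => univ.filter fun k => p ∈ S k with hKp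
  set K₀ : Finset (Fin K) := univ.filter fun k => ∀ p ∈ A, p ∉ S k with hK₀
  set H : Fin Z → Bool → ℂ := fun p β => ∏ k ∈ Kp p, X k (Function.update b₀ p β) with hH
  -- values ±1 and norms
  have hXpm : ∀ k b, X k b = 1 ∨ X k b = -1 := by
    intro k b
    simp only [hX]
    split_ifs
    · exact Or.inr rfl
    · exact Or.inl rfl
  have hXn : ∀ k b, ‖X k b‖ = 1 := by
    intro k b
    rcases hXpm k b with h | h <;> rw [h] <;> simp
  have hHpm : ∀ p β, H p β = 1 ∨ H p β = -1 := by
    intro p β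
    simp only [hH]
    refine Finset.prod_induction _ (fun x : ℂ => x = 1 ∨ x = -1) ?_ (Or.inl rfl) (fun k _ => hXpm k _)
    rintro a c (rfl | rfl) (rfl | rfl) <;> norm_num
  have hHn : ∀ p β, ‖H p β‖ = 1 := by
    intro p β
    rcases hHpm p β with h | h <;> rw [h] <;> simp
  -- reading structure: `X k b` depends on `b` only through `b |_(S k ∩ A)`
  have hXread : ∀ k (b b' : Fin Z → Bool), (∀ p ∈ A, p ∈ S k → b p = b' p) → X k b = X k b' := by
    intro k b b' hbb'
    have e : σ k (subcubeMerge A b u) = σ k (subcubeMerge A b' u) := by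
      apply hread k
      intro i hi
      unfold subcubeMerge
      by_cases hiA : i ∈ A
      · rw [if_pos hiA, if_pos hiA]
        exact hbb' i hiA hi
      · rw [if_neg hiA, if_neg hiA]
    simp only [hX, e]
  -- the partition of the tables by their point in `A`
  have huniv : (univ : Finset (Fin K)) = K₀ ∪ A.biUnion Kp := by
    ext k
    simp only [mem_union, mem_univ, true_iff, mem_biUnion, hK₀, hKp, mem_filter, true_and]
    by_cases h : ∃ p ∈ A, p ∈ S k
    · exact Or.inr h
    · exact Or.inl fun p hpA hpS => h ⟨p, hpA, hpS⟩
  have hdisj : Disjoint K₀ (A.biUnion Kp) := by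
    rw [Finset.disjoint_left]
    intro k hk hk'
    simp only [hK₀, mem_filter, mem_univ, true_and] at hk
    simp only [mem_biUnion, hKp, mem_filter, mem_univ, true_and] at hk'
    obtain ⟨p, hpA, hpS⟩ := hk'
    exact hk p hpA hpS
  have hpw : (A : Set (Fin Z)).PairwiseDisjoint Kp := by
    intro p hp q hq hpq
    show Disjoint (Kp p) (Kp q)
    rw [Finset.disjoint_left]
    intro k hkp hkq
    simp only [hKp, mem_filter, mem_univ, true_and] at hkp hkq
    exact hpq (Finset.card_le_one.mp (hA k) p (mem_inter.mpr ⟨hkp, Finset.mem_coe.mp hp⟩)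
      q (mem_inter.mpr ⟨hkq, Finset.mem_coe.mp hq⟩))
  refine ⟨(∏ k ∈ K₀, X k b₀) * ∏ p ∈ A, H p false, fun p => decide (p ∈ A ∧ H p false ≠ H p true), ?_, ?_⟩
  · rw [norm_mul, norm_prod, norm_prod, Finset.prod_eq_one (fun k _ => hXn k b₀),
      Finset.prod_eq_one (fun p _ => hHn p false), one_mul]
  · intro b
    show (∏ k, X k b) = _
    -- step B: tables avoiding `A` are constant on the part
    have hB : ∏ k ∈ K₀, X k b = ∏ k ∈ K₀, X k b₀ := by
      refine Finset.prod_congr rfl fun k hk => hXread k b b₀ fun p hpA hpS => ?_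
      simp only [hK₀, mem_filter, mem_univ, true_and] at hk
      exact absurd hpS (hk p hpA)
    -- steps C + D: tables through `p ∈ A` give `H p (b p) = H p false · (±1)^{b p}`
    have hCD : ∀ p ∈ A, ∏ k ∈ Kp p, X k b
        = H p false * (if b p ∧ decide (p ∈ A ∧ H p false ≠ H p true) then (-1 : ℂ) else 1) := by
      intro p hp
      have hC : ∏ k ∈ Kp p, X k b = H p (b p) := by
        simp only [hH]
        refine Finset.prod_congr rfl fun k hk => hXread k b _ fun q hqA hqS => ?_
        simp only [hKp, mem_filter, mem_univ, true_and] at hk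
        have hqp : q = p := Finset.card_le_one.mp (hA k) q (mem_inter.mpr ⟨hqS, hqA⟩) p (mem_inter.mpr ⟨hk, hp⟩)
        rw [hqp, Function.update_self]
      rw [hC]
      rcases hHpm p false with h0 | h0 <;> rcases hHpm p true with h1 | h1 <;>
        cases hbp : b p <;> simp [h0, h1, hp] <;> norm_num
    -- the sign table vanishes off `A`
    have hE : ∏ p ∈ A, (if b p ∧ decide (p ∈ A ∧ H p false ≠ H p true) then (-1 : ℂ) else 1)
        = ∏ p, (if b p ∧ decide (p ∈ A ∧ H p false ≠ H p true) then (-1 : ℂ) else 1) := by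
      refine Finset.prod_subset (subset_univ A) fun p _ hp => ?_
      simp [hp]
    rw [huniv, Finset.prod_union hdisj, Finset.prod_biUnion hpw, hB, Finset.prod_congr rfl hCD, Finset.prod_mul_distrib, hE]
    ring

/-- **`VDOfJPD`** (ROUND-22 §2.5 corollary; prover target S, counting only): a frame `V` with every nonzero combination of weight `≥ δZ` and a
junta product with `Σ_k |S_k|² ≤ Λ₂` have EVERY nontrivial frame-character correlation `≤ (√3/2)^{⌈δ²Z²/(δZ+Λ₂)⌉}` — hence (FA-Var, §4)
variance decorrelation `VD ≤ 3^m (3/4)^{δ²Z²/(δZ+Λ₂)}`: frame averaging with arbitrary junta tables of width `L` is valid for frames of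
dimension `m ≤ c·δ²Z/(δ + κL²)` ((M2) with explicit `μ₀`, VW-free). -/
def VDOfJPD : Prop :=
  JuntaProductDecorrelation →
  ∀ (Z K m : ℕ) (S : Fin K → Finset (Fin Z)) (σ : Fin K → (Fin Z → Bool) → Bool) (V : Fin m → Fin Z → ZMod 3) (δ Λ₂ : ℝ),
    0 < δ → (∀ k, ReadsOnly (S k) (σ k)) → ((∑ k, ((S k).card : ℝ) * ((S k).card - 1)) ≤ Λ₂) → 0 ≤ Λ₂ →
    (∀ t : Fin m → ZMod 3, t ≠ 0 → δ * Z ≤ ((univ.filter fun p : Fin Z => (∑ l, t l * V l p) ≠ 0).card : ℝ)) →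
      ∀ t : Fin m → ZMod 3, t ≠ 0 →
        ‖∑ F : Fin Z → Bool, Complex.exp (2 * Real.pi * Complex.I / 3) ^ (∑ p, if F p then (∑ l, t l * V l p).val else 0) *
            ∏ k, (if σ k F then (-1 : ℂ) else 1)‖
          ≤ (2 : ℝ) ^ Z * (Real.sqrt 3 / 2) ^ ((δ * Z) ^ 2 / (δ * Z + Λ₂))

end AffBells23

end Summit.QuantumAdvantage.AdviceFreeQNC0
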